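import Literature.Probability.LatticeModels.GHSInequality
import Literature.Probability.LatticeModels.MagnetizationTransport
import HarnessLib

/-!
# The fixed-boundary-condition Ising model as a spin system with effective boundary fields;
# deformation by an extra field on a set of sites (GHS concavity, pressure derivative)

Topic `Probability/LatticeModels`, namespace `Literature.Probability.LatticeModels`.

For the finite-volume Ising model `μ^η_{Λ;β,h}` on a locally finite graph with a FIXED boundary
condition `η` (Friedli–Velenik 2017, §3.1, eq. (3.6)), the boundary bonds `{y,z}`, `y ∈ Λ`,
`z ∉ Λ`, act on the spin `σ_y` as an effective magnetic field `β ∑_{z ∼ y, z ∉ Λ} η_z`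
(Friedli–Velenik 2017, §3.8.1, p. 141: "`K_{{i}} = h + β #{j ∉ Λ : j ∼ i}`" for `η ≡ +1`). This
file records the model in that form — a spin system `ν_{Λ;K}` of `GKSInequalities` indexed by the
edges INSIDE `Λ` (coupling `β`) and the sites of `Λ` (coupling `β (h + ∑_{z ∼ y, z ∉ Λ} η_z)`),
`effIdx` / `effCoupling` / `isingSupp` — so that boundary conditions whose spins have both signs
but produce NONNEGATIVE effective fields (e.g. the internal-spin systems of van
Enter–Fernández–Sokal 1993, §4.3.1, where the fields of alternating image spins cancel) become
accessible to the GKS / GHS inequalities, which are stated for nonnegative couplings.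

It then studies the deformation `K + t·𝟙_D` by an extra field `t` on a set of sites `D ⊆ Λ`
(an affine coupling path `affCpl`, `MagnetizationTransport`), the tool of the GHS route to
uniqueness (Preston 1974; Friedli–Velenik 2017, Remark 3.41 and §3.9): the one-point functions
are concave in `t` as long as all couplings stay nonnegative (GHS, `gksExpect_ghs`), the
log-partition function has derivative `∑_{y ∈ D} ⟨σ_y⟩_t`, which is nondecreasing in `t`
(its derivative is a variance), and two coupling vectors give log-partition functions differing
by at most `∑ᵢ |Kᵢ - K'ᵢ|`.

## Main statements (all proved)

* `sum_edgeBoundary_bondSpin` — `∑_{e ∈ ∂ᵉΛ} σ_e = ∑_{y ∈ Λ} σ_y ∑_{z ∼ y, z ∉ Λ} σ_z`.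
* `gksHamiltonian_eff`, `isingWeight_eq_gksWeight_eff`, `isingPartitionFunction_eq_gksSum_eff`,
  `isingExpect_fixed_eq_gksExpect_eff`, `isingCorr_fixed_eq_gksExpect_eff` — the representation.
* `effCoupling_nonneg` — nonnegative couplings from nonnegative effective fields.
* `concaveOn_gksExpect_spinAt_affCpl` — GHS: `t ↦ ⟨σ_x⟩_{K + tW}` is concave where `K + tW ≥ 0`,
  for a direction `W ≥ 0` supported on one-site terms.
* `hasDerivAt_log_gksSum_affCpl`, `monotone_sum_gksExpect_affCpl`,
  `log_gksSum_affCpl_sub_mem` — pressure derivative and its monotonicity (convexity).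
* `abs_log_gksSum_sub_log_gksSum_le` — `|log Z_K - log Z_{K'}| ≤ ∑ᵢ |Kᵢ - K'ᵢ|` (`|σ_C| ≤ 1`).
* Ising specialisation (Part C): `siteDir`, `deformedExpect` / `deformedZ` / `deformedMag` (the
  fixed-b.c. model with an extra field `t` on `D`), `deformedExpect_zero` (`t = 0` is the Ising
  expectation), `affCpl_effCoupling_siteDir_nonneg`, `concaveOn_deformedExpect_spinAt` (GHS
  concavity on `[-βm, ∞)` when the sites of `D` carry effective field `≥ m`),
  `hasDerivAt_log_deformedZ`, `monotone_deformedMag`, `log_deformedZ_sub_mem`,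
  `abs_log_deformedZ_sub_le`.

## References

* S. Friedli, Y. Velenik, *Statistical Mechanics of Lattice Systems* (CUP 2017), §3.1 eq. (3.6),
  §3.8.1 p. 141, Remark 3.41, §3.9 [FriedliVelenik2017].
* J. L. Lebowitz, *GHS and other inequalities*, Comm. Math. Phys. 35 (1974) 87 [Lebowitz1974].
* C. J. Preston, *An application of the GHS inequalities to show the absence of phase transition
  for Ising spin systems*, Comm. Math. Phys. 35 (1974) 253–255 (the GHS route to uniqueness).
* A. C. D. van Enter, R. Fernández, A. D. Sokal, J. Stat. Phys. 72 (1993) 879, §4.3.1 Step 2.2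
  [VanenterFernandezSokal1993] (the intended application).
-/

noncomputable section

open Finset MeasureTheory Set
open scoped symmDiff

namespace Literature.Probability.LatticeModels

/-! ## Part A. Boundary bonds as effective fields -/

section EffField

variable {V : Type*} [DecidableEq V] (G : SimpleGraph V) [G.LocallyFinite]

/-- The neighbours of `y` outside `Λ`. [cite: FriedliVelenik2017, §3.1 (∂ᵉˣΛ)] -/
def outNbrs (Λ : Finset V) (y : V) : Finset V :=
  (G.neighborFinset y).filter fun z => z ∉ Λ

/-- Membership in `outNbrs`. [cite: FriedliVelenik2017, §3.1] -/
@[simp] theorem mem_outNbrs {Λ : Finset V} {y z : V} :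
    z ∈ outNbrs G Λ y ↔ G.Adj y z ∧ z ∉ Λ := by
  simp [outNbrs]

/-- **The effective boundary field** at a site `y` produced by the configuration `η` outside `Λ`:
`∑_{z ∼ y, z ∉ Λ} η_z` (Friedli–Velenik 2017, §3.8.1, p. 141: the boundary bonds `{i,j}`,
`j ∉ Λ`, contribute `β η_j σ_i`, i.e. `K_{{i}} = h + β #{j ∉ Λ : j ∼ i}` for `η ≡ +1`).
[cite: FriedliVelenik2017, §3.8.1, p. 141] -/
def bdryField (Λ : Finset V) (η : SpinConfig V) (y : V) : ℝ :=
  ∑ z ∈ outNbrs G Λ y, spinAt z η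

/-- `|∑_{z ∼ y, z ∉ Λ} η_z| ≤ #{z ∼ y : z ∉ Λ}`. [cite: FriedliVelenik2017, §3.8.1, p. 141] -/
theorem abs_bdryField_le (Λ : Finset V) (η : SpinConfig V) (y : V) :
    |bdryField G Λ η y| ≤ #(outNbrs G Λ y) := by
  unfold bdryField
  calc |∑ z ∈ outNbrs G Λ y, spinAt z η| ≤ ∑ z ∈ outNbrs G Λ y, |spinAt z η| :=
        Finset.abs_sum_le_sum_abs _ _
    _ = #(outNbrs G Λ y) := by simp


/-- The boundary field depends on `η` only through the outside neighbours of `y`.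
[cite: FriedliVelenik2017, §3.1] -/
theorem bdryField_congr {Λ : Finset V} {η η' : SpinConfig V} {y : V}
    (h : ∀ z, G.Adj y z → z ∉ Λ → η z = η' z) : bdryField G Λ η y = bdryField G Λ η' y := by
  unfold bdryField
  refine Finset.sum_congr rfl fun z hz => ?_
  rw [mem_outNbrs] at hz
  simp [spinAt, h z hz.1 hz.2]

/-- **`∑_{e ∈ ∂ᵉΛ} σ_e = ∑_{y ∈ Λ} σ_y ∑_{z ∼ y, z ∉ Λ} σ_z`**: every boundary bond has exactly
one endpoint in `Λ` (Friedli–Velenik 2017, §3.1, eq. (3.6) regrouped by the inner endpoint).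
[cite: FriedliVelenik2017, §3.1, eq. (3.6)] -/
theorem sum_edgeBoundary_bondSpin (Λ : Finset V) (σ : SpinConfig V) :
    ∑ e ∈ edgeBoundary G Λ, bondSpin σ e =
      ∑ y ∈ Λ, spinAt y σ * ∑ z ∈ outNbrs G Λ y, spinAt z σ := by
  classical
  simp_rw [Finset.mul_sum]
  rw [Finset.sum_sigma']
  symm
  refine Finset.sum_bij (fun p _ => s(p.1, p.2)) ?_ ?_ ?_ ?_
  · rintro ⟨y, z⟩ hp
    rw [Finset.mem_sigma, mem_outNbrs] at hp
    rw [mem_edgeBoundary_iff]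
    exact ⟨(SimpleGraph.mem_edgeSet G).2 hp.2.1, ⟨y, hp.1, Sym2.mem_mk_left _ _⟩,
      ⟨z, hp.2.2, Sym2.mem_mk_right _ _⟩⟩
  · rintro ⟨y, z⟩ hp ⟨y', z'⟩ hp' heq
    rw [Finset.mem_sigma, mem_outNbrs] at hp hp'
    rcases Sym2.eq_iff.1 heq with ⟨rfl, rfl⟩ | ⟨rfl, rfl⟩
    · rfl
    · exact absurd hp'.1 hp.2.2
  · intro e he
    rw [mem_edgeBoundary_iff] at he
    obtain ⟨he, ⟨x, hx, hxe⟩, ⟨w, hw, hwe⟩⟩ := he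
    have hxw : x ≠ w := fun h => hw (h ▸ hx)
    have hexw : e = s(x, w) := (Sym2.mem_and_mem_iff hxw).1 ⟨hxe, hwe⟩
    refine ⟨⟨x, w⟩, ?_, hexw.symm⟩
    rw [Finset.mem_sigma, mem_outNbrs]
    refine ⟨hx, ?_, hw⟩
    rw [hexw] at he
    exact he
  · rintro ⟨y, z⟩ _
    rfl

/-- The index set of the effective-field representation: the edges INSIDE `Λ` and the sites of
`Λ`. [cite: FriedliVelenik2017, §3.8.1, p. 141] -/
def effIdx (Λ : Finset V) : Finset (Sym2 V ⊕ V) := (edgesIn G Λ).disjSum Λ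

/-- **The effective couplings** of `μ^η_{Λ;β,h}` (tree parametrisation `exp(-βH)`): `β` on an edge
inside `Λ`, and `β (h + ∑_{z ∼ y, z ∉ Λ} η_z)` on the site `y` (Friedli–Velenik 2017, §3.8.1,
p. 141). [cite: FriedliVelenik2017, §3.8.1, p. 141] -/
def effCoupling (Λ : Finset V) (β h : ℝ) (η : SpinConfig V) : Sym2 V ⊕ V → ℝ
  | .inl _ => β
  | .inr y => β * (h + bdryField G Λ η y)

/-- `effCoupling` on an edge index. [cite: FriedliVelenik2017, §3.8.1, p. 141] -/
@[simp] theorem effCoupling_inl (Λ : Finset V) (β h : ℝ) (η : SpinConfig V) (e : Sym2 V) :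
    effCoupling G Λ β h η (.inl e) = β := rfl

/-- `effCoupling` on a site index. [cite: FriedliVelenik2017, §3.8.1, p. 141] -/
@[simp] theorem effCoupling_inr (Λ : Finset V) (β h : ℝ) (η : SpinConfig V) (y : V) :
    effCoupling G Λ β h η (.inr y) = β * (h + bdryField G Λ η y) := rfl

/-- **Nonnegative effective fields give nonnegative couplings**: if `β ≥ 0` and
`h + ∑_{z ∼ y, z ∉ Λ} η_z ≥ 0` for every `y ∈ Λ`, all couplings of the representation are `≥ 0`
(so GKS and GHS apply although `η` may contain spins of both signs).
[cite: FriedliVelenik2017, §3.8.1, p. 141] -/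
theorem effCoupling_nonneg {Λ : Finset V} {β h : ℝ} (hβ : 0 ≤ β) {η : SpinConfig V}
    (hfield : ∀ y ∈ Λ, 0 ≤ h + bdryField G Λ η y) :
    ∀ i ∈ effIdx G Λ, 0 ≤ effCoupling G Λ β h η i := by
  rintro (e | y) hi
  · exact hβ
  · rw [effIdx, Finset.inr_mem_disjSum] at hi
    exact mul_nonneg hβ (hfield y hi)

/-- The site supports are singletons: `isingSupp Λ (inr y) = {⟨y, hy⟩}` for `y ∈ Λ`.
[cite: FriedliVelenik2017, §3.8.1, p. 141] -/
theorem isingSupp_inr_eq_singleton {Λ : Finset V} {y : V} (hy : y ∈ Λ) :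
    isingSupp Λ (.inr y) = {⟨y, hy⟩} := by
  ext z
  simp only [isingSupp, Finset.mem_filter, Finset.mem_univ, true_and, Finset.mem_singleton]
  constructor
  · intro h; exact Subtype.ext h
  · intro h; rw [h]

/-- **The fixed-b.c. Ising weight in effective-field form**:
`-β H^η_{Λ;h}(τ·η) = ∑_{e ∈ ℰ_Λ} β τ_e + ∑_{y ∈ Λ} β (h + ∑_{z∼y, z∉Λ} η_z) τ_y`
(Friedli–Velenik 2017, §3.1 eq. (3.6) and §3.8.1 p. 141). [cite: FriedliVelenik2017, §3.8.1, p. 141] -/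
theorem gksHamiltonian_eff (Λ : Finset V) (β h : ℝ) (η : SpinConfig V) (τ : SpinConfig ↥Λ) :
    gksHamiltonian (effIdx G Λ) (effCoupling G Λ β h η) (isingSupp Λ) τ =
      -β * isingHamiltonian G Λ h (.fixed η) (glue Λ τ (.fixed η)) := by
  classical
  set σ : SpinConfig V := glue Λ τ (.fixed η) with hσ
  rw [gksHamiltonian, effIdx, Finset.sum_disjSum, isingHamiltonian, interactionEdges_fixed]
  -- edges inside `Λ`
  have hE : ∑ e ∈ edgesIn G Λ, effCoupling G Λ β h η (.inl e) * spinProduct (isingSupp Λ (.inl e)) τ =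
      β * ∑ e ∈ edgesIn G Λ, bondSpin σ e := by
    rw [Finset.mul_sum]
    refine Finset.sum_congr rfl fun e he => ?_
    rw [mem_edgesIn_iff] at he
    induction e using Sym2.ind with
    | _ a b =>
      have hab : a ≠ b := G.ne_of_adj (by simpa using he.1)
      rw [effCoupling_inl, spinProduct_isingSupp_inl τ (.fixed η) hab, bondSpin_mk,
        if_pos (he.2 a (Sym2.mem_mk_left a b)), if_pos (he.2 b (Sym2.mem_mk_right a b))]
  -- sites
  have hS : ∑ y ∈ Λ, effCoupling G Λ β h η (.inr y) * spinProduct (isingSupp Λ (.inr y)) τ =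
      β * h * ∑ y ∈ Λ, spinAt y σ + β * ∑ y ∈ Λ, spinAt y σ * bdryField G Λ η y := by
    rw [Finset.mul_sum, Finset.mul_sum, ← Finset.sum_add_distrib]
    refine Finset.sum_congr rfl fun y hy => ?_
    rw [effCoupling_inr, spinProduct_isingSupp_inr τ (.fixed η) hy]
    ring
  -- the boundary bonds are the effective fields
  have hB : ∑ e ∈ edgeBoundary G Λ, bondSpin σ e = ∑ y ∈ Λ, spinAt y σ * bdryField G Λ η y := by
    rw [sum_edgeBoundary_bondSpin]
    refine Finset.sum_congr rfl fun y _ => ?_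
    unfold bdryField
    congr 1
    refine Finset.sum_congr rfl fun z hz => ?_
    rw [mem_outNbrs] at hz
    rw [hσ, spinAt_glue_of_not_mem τ (.fixed η) hz.2]
    rfl
  rw [hE, hS, ← Finset.sum_sdiff (edgesIn_subset_edgesTouching (G := G) Λ)]
  rw [show edgesTouching G Λ \ edgesIn G Λ = edgeBoundary G Λ from rfl, hB]
  ring

/-- The Boltzmann weight in effective-field form. [cite: FriedliVelenik2017, §3.8.1, p. 141] -/
theorem isingWeight_eq_gksWeight_eff (Λ : Finset V) (β h : ℝ) (η : SpinConfig V)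
    (τ : SpinConfig ↥Λ) :
    isingWeight G Λ β h (.fixed η) τ =
      gksWeight (effIdx G Λ) (effCoupling G Λ β h η) (isingSupp Λ) τ := by
  rw [isingWeight, gksWeight, gksHamiltonian_eff]

/-- The partition function in effective-field form: `Z^η_{Λ;β,h} = Z_{Λ;K_eff}`.
[cite: FriedliVelenik2017, §3.8.1, p. 141] -/
theorem isingPartitionFunction_eq_gksSum_eff (Λ : Finset V) (β h : ℝ) (η : SpinConfig V) :
    isingPartitionFunction G Λ β h (.fixed η) =
      gksSum (effIdx G Λ) (effCoupling G Λ β h η) (isingSupp Λ) (fun _ => 1) := by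
  simp [isingPartitionFunction, gksSum, isingWeight_eq_gksWeight_eff]

/-- **Expectations in effective-field form**: for a measurable observable `f`,
`⟨f⟩^η_{Λ;β,h} = ⟨τ ↦ f(τ·η)⟩_{Λ;K_eff}`. [cite: FriedliVelenik2017, §3.8.1, p. 141] -/
theorem isingExpect_fixed_eq_gksExpect_eff (Λ : Finset V) (β h : ℝ) (η : SpinConfig V)
    {f : SpinConfig V → ℝ} (hf : Measurable f) :
    isingExpect G Λ β h (.fixed η) f =
      gksExpect (effIdx G Λ) (effCoupling G Λ β h η) (isingSupp Λ)
        (fun τ => f (glue Λ τ (.fixed η))) := by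
  rw [isingExpect, integral_isingMeasure G Λ β h _ hf, gksExpect, gksSum, gksSum,
    isingPartitionFunction]
  congr 1
  · refine Finset.sum_congr rfl fun τ _ => ?_
    rw [isingWeight_eq_gksWeight_eff, mul_comm]
  · refine Finset.sum_congr rfl fun τ _ => ?_
    rw [isingWeight_eq_gksWeight_eff, one_mul]

/-- Correlations in effective-field form: `⟨σ_A⟩^η_{Λ;β,h} = ⟨σ_A⟩_{Λ;K_eff}` for `A ⊆ Λ`.
[cite: FriedliVelenik2017, §3.8.1, p. 141] -/
theorem isingCorr_fixed_eq_gksExpect_eff (Λ : Finset V) (β h : ℝ) (η : SpinConfig V)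
    {A : Finset V} (hA : A ⊆ Λ) :
    isingCorr G Λ β h (.fixed η) A =
      gksExpect (effIdx G Λ) (effCoupling G Λ β h η) (isingSupp Λ) (spinProduct (inVol Λ A)) := by
  rw [isingCorr, isingExpect_fixed_eq_gksExpect_eff G Λ β h η (measurable_spinProduct A)]
  congr 1
  funext τ
  exact spinProduct_glue_of_subset hA τ _

/-- One-point functions in effective-field form: `⟨σ_y⟩^η_{Λ;β,h} = ⟨σ_y⟩_{Λ;K_eff}`, `y ∈ Λ`.
[cite: FriedliVelenik2017, §3.8.1, p. 141] -/
theorem isingExpect_spinAt_fixed_eq_gksExpect_eff (Λ : Finset V) (β h : ℝ) (η : SpinConfig V)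
    {y : V} (hy : y ∈ Λ) :
    isingExpect G Λ β h (.fixed η) (spinAt y) =
      gksExpect (effIdx G Λ) (effCoupling G Λ β h η) (isingSupp Λ) (spinAt ⟨y, hy⟩) := by
  rw [isingExpect_fixed_eq_gksExpect_eff G Λ β h η (measurable_spinAt y)]
  congr 1
  funext τ
  exact spinAt_glue_of_mem τ _ hy

end EffField

/-! ## Part B. Deformation of a spin system by an extra field: GHS concavity and the pressure -/

section Deform

variable {Λ : Type*} [Fintype Λ] [DecidableEq Λ] {ι : Type*}
variable (s : Finset ι) (K W : ι → ℝ) (C : ι → Finset Λ)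

/-- Linearity of `⟨·⟩_{Λ;K}`. [folklore] -/
theorem gksExpect_add (f g : SpinConfig Λ → ℝ) :
    gksExpect s K C (fun ω => f ω + g ω) = gksExpect s K C f + gksExpect s K C g := by
  rw [gksExpect, gksExpect, gksExpect, ← add_div]
  congr 1
  exact gksSum_add s K C f g

/-- Homogeneity of `⟨·⟩_{Λ;K}`. [folklore] -/
theorem gksExpect_smul (a : ℝ) (f : SpinConfig Λ → ℝ) :
    gksExpect s K C (fun ω => a * f ω) = a * gksExpect s K C f := by
  rw [gksExpect, gksExpect, gksSum_smul, mul_div_assoc]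

/-- `⟨1⟩_{Λ;K} = 1`. [folklore] -/
theorem gksExpect_one : gksExpect s K C (fun _ => (1 : ℝ)) = 1 :=
  div_self (gksSum_one_pos s K C).ne'

/-- Positivity of `⟨·⟩_{Λ;K}` on nonnegative observables. [folklore] -/
theorem gksExpect_nonneg {f : SpinConfig Λ → ℝ} (hf : ∀ ω, 0 ≤ f ω) : 0 ≤ gksExpect s K C f :=
  div_nonneg (Finset.sum_nonneg fun ω _ => mul_nonneg (hf ω) (gksWeight_pos s K C ω).le)
    (gksSum_one_pos s K C).le

/-- `|⟨f⟩_{Λ;K}| ≤ M` when `|f| ≤ M` pointwise. [folklore] -/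
theorem abs_gksExpect_le {f : SpinConfig Λ → ℝ} {M : ℝ} (hf : ∀ ω, |f ω| ≤ M) :
    |gksExpect s K C f| ≤ M := by
  have hZ := gksSum_one_pos s K C
  rw [gksExpect, abs_div, abs_of_pos hZ, div_le_iff₀ hZ]
  calc |gksSum s K C f| ≤ ∑ ω, |f ω * gksWeight s K C ω| := Finset.abs_sum_le_sum_abs _ _
    _ ≤ ∑ ω, M * gksWeight s K C ω := Finset.sum_le_sum fun ω _ => by
        rw [abs_mul, abs_of_pos (gksWeight_pos s K C ω)]
        exact mul_le_mul_of_nonneg_right (hf ω) (gksWeight_pos s K C ω).le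
    _ = M * gksSum s K C (fun _ => 1) := by rw [gksSum, Finset.mul_sum]; simp

/-- In particular `|⟨σₓ⟩_{Λ;K}| ≤ 1`. [folklore] -/
theorem abs_gksExpect_spinAt_le_one (x : Λ) : |gksExpect s K C (spinAt x)| ≤ 1 :=
  abs_gksExpect_le s K C fun ω => (abs_spinAt x ω).le

/-- **Variances are nonnegative**: `⟨F²⟩_{Λ;K} - ⟨F⟩²_{Λ;K} ≥ 0` (any real couplings).
[folklore] -/
theorem gksExpect_sq_sub_sq_nonneg (F : SpinConfig Λ → ℝ) :
    0 ≤ gksExpect s K C (fun ω => F ω * F ω) - gksExpect s K C F * gksExpect s K C F := by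
  set c := gksExpect s K C F with hc
  have h := gksExpect_nonneg s K C (f := fun ω => (F ω - c) * (F ω - c))
    (fun ω => mul_self_nonneg _)
  have hexp : gksExpect s K C (fun ω => (F ω - c) * (F ω - c)) =
      gksExpect s K C (fun ω => F ω * F ω) - c * c := by
    have e1 : (fun ω => (F ω - c) * (F ω - c)) =
        fun ω => F ω * F ω + ((-(2 * c)) * F ω + c * c) := by
      funext ω; ring
    rw [e1, gksExpect_add, gksExpect_add, gksExpect_smul]
    have e2 : gksExpect s K C (fun _ => c * c) = c * c := by
      have := gksExpect_smul s K C (c * c) (fun _ => (1 : ℝ))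
      rw [gksExpect_one, mul_one] at this
      simpa using this
    rw [e2, ← hc]
    ring
  rw [hexp] at h
  exact h

/-- `⟨H_W⟩ = ∑ᵢ Wᵢ ⟨σ_{Cᵢ}⟩` and `⟨F H_W⟩ = ∑ᵢ Wᵢ ⟨F σ_{Cᵢ}⟩`. [folklore] -/
theorem gksExpect_mul_gksHamiltonian (K' : ι → ℝ) (F : SpinConfig Λ → ℝ) :
    gksExpect s K' C (fun ω => F ω * gksHamiltonian s W C ω) =
      ∑ i ∈ s, W i * gksExpect s K' C (fun ω => F ω * spinProduct (C i) ω) := by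
  rw [gksExpect, gksSum_mul_gksHamiltonian, Finset.sum_div]
  refine Finset.sum_congr rfl fun i _ => ?_
  rw [gksExpect, mul_div_assoc]

/-- **The derivative of the log-partition function along `K + tW`** is the mean energy in the
direction `W`: `d/dt log Z_{K+tW} = ∑ᵢ Wᵢ ⟨σ_{Cᵢ}⟩_{K+tW}` (Friedli–Velenik 2017, §3.7, proof of
Prop. 3.29: `m_Λ = ∂ψ_Λ/∂h`, here for a general direction). [cite: FriedliVelenik2017, §3.7, proof of Prop. 3.29] -/
theorem hasDerivAt_log_gksSum_affCpl (t : ℝ) :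
    HasDerivAt (fun t => Real.log (gksSum s (affCpl K W t) C (fun _ => 1)))
      (∑ i ∈ s, W i * gksExpect s (affCpl K W t) C (spinProduct (C i))) t := by
  have hD := hasDerivAt_gksSum_affCpl s K W C (fun _ => 1) t
  have hlog := hD.log (gksSum_one_pos _ _ _).ne'
  convert hlog using 1
  rw [← gksExpect, gksExpect_mul_gksHamiltonian]
  simp only [one_mul]

/-- **The mean energy in a direction `W` is nondecreasing along `K + tW`** (its derivative is the
variance of `H_W`; the convexity of the pressure, Friedli–Velenik 2017, §3.2.2 / Lemma 3.5).
[cite: FriedliVelenik2017, §3.7, Prop. 3.29 (convexity of the pressure in h)] -/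
theorem monotone_sum_gksExpect_affCpl :
    Monotone fun t => ∑ i ∈ s, W i * gksExpect s (affCpl K W t) C (spinProduct (C i)) := by
  set H : SpinConfig Λ → ℝ := gksHamiltonian s W C with hH
  have hfun : (fun t => ∑ i ∈ s, W i * gksExpect s (affCpl K W t) C (spinProduct (C i))) =
      fun t => gksExpect s (affCpl K W t) C H := by
    funext t
    have := gksExpect_mul_gksHamiltonian s W C (affCpl K W t) (fun _ => 1)
    simp only [one_mul] at this
    rw [hH, ← this]
  rw [hfun]
  have hderiv : ∀ t, HasDerivAt (fun t => gksExpect s (affCpl K W t) C H)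
      (gksExpect s (affCpl K W t) C (fun ω => H ω * H ω) -
        gksExpect s (affCpl K W t) C H * gksExpect s (affCpl K W t) C H) t := by
    intro t
    have h := hasDerivAt_gksExpect_affCpl_cov s K W C H t
    refine h.congr_deriv ?_
    have e2 : ∑ i ∈ s, W i * (gksExpect s (affCpl K W t) C H *
        gksExpect s (affCpl K W t) C (spinProduct (C i))) =
        gksExpect s (affCpl K W t) C H * gksExpect s (affCpl K W t) C H := by
      have := gksExpect_mul_gksHamiltonian s W C (affCpl K W t) (fun _ => 1)
      simp only [one_mul] at this
      rw [← hH] at this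
      rw [this, Finset.mul_sum]
      refine Finset.sum_congr rfl fun i _ => by ring
    have e1 : ∑ i ∈ s, W i * (gksExpect s (affCpl K W t) C (fun ω => H ω * spinProduct (C i) ω) -
        gksExpect s (affCpl K W t) C H * gksExpect s (affCpl K W t) C (spinProduct (C i))) =
        ∑ i ∈ s, W i * gksExpect s (affCpl K W t) C (fun ω => H ω * spinProduct (C i) ω) -
          ∑ i ∈ s, W i * (gksExpect s (affCpl K W t) C H *
            gksExpect s (affCpl K W t) C (spinProduct (C i))) := by
      rw [← Finset.sum_sub_distrib]
      exact Finset.sum_congr rfl fun i _ => by ring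
    rw [e1, e2, ← gksExpect_mul_gksHamiltonian]
  refine monotone_of_deriv_nonneg (fun t => (hderiv t).differentiableAt) fun t => ?_
  rw [(hderiv t).deriv]
  exact gksExpect_sq_sub_sq_nonneg _ _ _ H

/-- **Pressure increments are bracketed by the mean energies** (convexity of `t ↦ log Z_{K+tW}`
and the mean value theorem): for `t₁ ≤ t₂`,
`(t₂-t₁) ∑ᵢ Wᵢ⟨σ_{Cᵢ}⟩_{t₁} ≤ log Z_{t₂} - log Z_{t₁} ≤ (t₂-t₁) ∑ᵢ Wᵢ⟨σ_{Cᵢ}⟩_{t₂}`.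
[cite: FriedliVelenik2017, §3.7, Prop. 3.29 and its proof] -/
theorem log_gksSum_affCpl_sub_mem {t₁ t₂ : ℝ} (ht : t₁ ≤ t₂) :
    (t₂ - t₁) * ∑ i ∈ s, W i * gksExpect s (affCpl K W t₁) C (spinProduct (C i)) ≤
        Real.log (gksSum s (affCpl K W t₂) C (fun _ => 1)) -
          Real.log (gksSum s (affCpl K W t₁) C (fun _ => 1)) ∧
      Real.log (gksSum s (affCpl K W t₂) C (fun _ => 1)) -
          Real.log (gksSum s (affCpl K W t₁) C (fun _ => 1)) ≤
        (t₂ - t₁) * ∑ i ∈ s, W i * gksExpect s (affCpl K W t₂) C (spinProduct (C i)) := by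
  rcases ht.eq_or_lt with rfl | hlt
  · simp
  set F : ℝ → ℝ := fun t => Real.log (gksSum s (affCpl K W t) C (fun _ => 1)) with hF
  set A : ℝ → ℝ := fun t => ∑ i ∈ s, W i * gksExpect s (affCpl K W t) C (spinProduct (C i))
    with hA
  obtain ⟨ξ, hξ, hξeq⟩ := exists_hasDerivAt_eq_slope F A hlt
    (fun t _ => (hasDerivAt_log_gksSum_affCpl s K W C t).continuousAt.continuousWithinAt)
    (fun t _ => hasDerivAt_log_gksSum_affCpl s K W C t)
  have hpos : 0 < t₂ - t₁ := by linarith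
  have hslope : F t₂ - F t₁ = (t₂ - t₁) * A ξ := by
    rw [hξeq]; field_simp
  have hmono := monotone_sum_gksExpect_affCpl s K W C
  have h1 : A t₁ ≤ A ξ := hmono hξ.1.le
  have h2 : A ξ ≤ A t₂ := hmono hξ.2.le
  simp only [hF] at hslope
  constructor
  · rw [hslope]; exact mul_le_mul_of_nonneg_left h1 hpos.le
  · rw [hslope]; exact mul_le_mul_of_nonneg_left h2 hpos.le

/-- **Two coupling vectors give comparable partition functions**:
`|log Z_{Λ;K} - log Z_{Λ;K'}| ≤ ∑ᵢ |Kᵢ - K'ᵢ|` (`|σ_C| ≤ 1`; the boundary estimate of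
Friedli–Velenik 2017, §3.2.1, in the form used for comparing boundary conditions).
[cite: FriedliVelenik2017, §3.2.1, proof of Thm. 3.6 (boundary terms)] -/
theorem abs_log_gksSum_sub_log_gksSum_le (K' : ι → ℝ) :
    |Real.log (gksSum s K C (fun _ => 1)) - Real.log (gksSum s K' C (fun _ => 1))| ≤
      ∑ i ∈ s, |K i - K' i| := by
  set B : ℝ := ∑ i ∈ s, |K i - K' i| with hB
  have hH : ∀ ω : SpinConfig Λ, |gksHamiltonian s K C ω - gksHamiltonian s K' C ω| ≤ B := by
    intro ω
    rw [gksHamiltonian, gksHamiltonian, ← Finset.sum_sub_distrib]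
    refine (Finset.abs_sum_le_sum_abs _ _).trans (Finset.sum_le_sum fun i _ => ?_)
    rw [← sub_mul, abs_mul]
    exact mul_le_of_le_one_right (abs_nonneg _) (abs_spinProduct_le_one _ _)
  have hup : ∀ ω, gksWeight s K C ω ≤ gksWeight s K' C ω * Real.exp B := fun ω => by
    rw [gksWeight, gksWeight, ← Real.exp_add]
    exact Real.exp_le_exp.2 (by linarith [le_of_abs_le (hH ω)])
  have hlow : ∀ ω, gksWeight s K' C ω * Real.exp (-B) ≤ gksWeight s K C ω := fun ω => by
    rw [gksWeight, gksWeight, ← Real.exp_add]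
    exact Real.exp_le_exp.2 (by linarith [neg_le_of_abs_le (hH ω)])
  have hZ := gksSum_one_pos s K C
  have hZ' := gksSum_one_pos s K' C
  have hZup : gksSum s K C (fun _ => 1) ≤ gksSum s K' C (fun _ => 1) * Real.exp B := by
    simp only [gksSum, one_mul, Finset.sum_mul]
    exact Finset.sum_le_sum fun ω _ => hup ω
  have hZlow : gksSum s K' C (fun _ => 1) * Real.exp (-B) ≤ gksSum s K C (fun _ => 1) := by
    simp only [gksSum, one_mul, Finset.sum_mul]
    exact Finset.sum_le_sum fun ω _ => hlow ω
  rw [abs_le]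
  constructor
  · have := Real.log_le_log (mul_pos hZ' (Real.exp_pos _)) hZlow
    rw [Real.log_mul hZ'.ne' (Real.exp_pos _).ne', Real.log_exp] at this
    linarith
  · have := Real.log_le_log hZ hZup
    rw [Real.log_mul hZ'.ne' (Real.exp_pos _).ne', Real.log_exp] at this
    linarith

/-! ### GHS concavity of the one-point function along a nonnegative one-site direction -/

/-- The derivative of a truncated two-point function `⟨σₓσ_y⟩ - ⟨σₓ⟩⟨σ_y⟩` along `K + tW`.
[cite: GlimmJaffe1987, §4.2, Prop. 4.2.1] -/
theorem hasDerivAt_gksTrunc_affCpl (x y : Λ) (t : ℝ) :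
    HasDerivAt (fun t => gksExpect s (affCpl K W t) C (fun σ => spinAt x σ * spinAt y σ) -
        gksExpect s (affCpl K W t) C (spinAt x) * gksExpect s (affCpl K W t) C (spinAt y))
      (∑ i ∈ s, W i *
        ((gksExpect s (affCpl K W t) C (fun σ => spinAt x σ * spinAt y σ * spinProduct (C i) σ) -
            gksExpect s (affCpl K W t) C (fun σ => spinAt x σ * spinAt y σ) *
              gksExpect s (affCpl K W t) C (spinProduct (C i))) -
          gksExpect s (affCpl K W t) C (spinAt y) *
            (gksExpect s (affCpl K W t) C (fun σ => spinAt x σ * spinProduct (C i) σ) -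
              gksExpect s (affCpl K W t) C (spinAt x) *
                gksExpect s (affCpl K W t) C (spinProduct (C i))) -
          gksExpect s (affCpl K W t) C (spinAt x) *
            (gksExpect s (affCpl K W t) C (fun σ => spinAt y σ * spinProduct (C i) σ) -
              gksExpect s (affCpl K W t) C (spinAt y) *
                gksExpect s (affCpl K W t) C (spinProduct (C i))))) t := by
  have hxy := hasDerivAt_gksExpect_affCpl_cov s K W C (fun σ => spinAt x σ * spinAt y σ) t
  have hx := hasDerivAt_gksExpect_affCpl_cov s K W C (spinAt x) t
  have hy := hasDerivAt_gksExpect_affCpl_cov s K W C (spinAt y) t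
  refine (hxy.sub (hx.mul hy)).congr_deriv ?_
  rw [Finset.sum_mul, Finset.mul_sum, ← Finset.sum_add_distrib, ← Finset.sum_sub_distrib]
  refine Finset.sum_congr rfl fun i _ => ?_
  ring

/-- **The sign of that derivative (GHS)**: if all couplings `K + tW` are nonnegative on supports
of at most two sites, `W ≥ 0`, and `W` acts only on one-site terms, then
`d/dt (⟨σₓσ_y⟩ - ⟨σₓ⟩⟨σ_y⟩) = ∑ᵢ Wᵢ u₃(x, y, zᵢ) ≤ 0` (Lebowitz 1974, Remark (ii): for
nonnegative fields the truncated pair function is nonincreasing in the fields).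
[cite: Lebowitz1974, eq. (1.8) and §2, Remark (ii)] -/
theorem deriv_gksTrunc_affCpl_nonpos (hC : ∀ i ∈ s, (C i).card ≤ 2)
    (hW : ∀ i ∈ s, 0 ≤ W i) (hW1 : ∀ i ∈ s, W i ≠ 0 → ∃ z, C i = {z}) {t : ℝ}
    (hKt : ∀ i ∈ s, 0 ≤ affCpl K W t i) (x y : Λ) :
    (∑ i ∈ s, W i *
        ((gksExpect s (affCpl K W t) C (fun σ => spinAt x σ * spinAt y σ * spinProduct (C i) σ) -
            gksExpect s (affCpl K W t) C (fun σ => spinAt x σ * spinAt y σ) *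
              gksExpect s (affCpl K W t) C (spinProduct (C i))) -
          gksExpect s (affCpl K W t) C (spinAt y) *
            (gksExpect s (affCpl K W t) C (fun σ => spinAt x σ * spinProduct (C i) σ) -
              gksExpect s (affCpl K W t) C (spinAt x) *
                gksExpect s (affCpl K W t) C (spinProduct (C i))) -
          gksExpect s (affCpl K W t) C (spinAt x) *
            (gksExpect s (affCpl K W t) C (fun σ => spinAt y σ * spinProduct (C i) σ) -
              gksExpect s (affCpl K W t) C (spinAt y) *
                gksExpect s (affCpl K W t) C (spinProduct (C i))))) ≤ 0 := by
  refine Finset.sum_nonpos fun i hi => ?_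
  by_cases hWi : W i = 0
  · rw [hWi, zero_mul]
  obtain ⟨z, hz⟩ := hW1 i hi hWi
  have hsp : spinProduct (C i) = spinAt z := by
    funext σ; rw [hz, spinProduct, Finset.prod_singleton]
  simp only [hsp]
  have hghs := gksExpect_ghs s (affCpl K W t) C hKt hC x y z
  refine mul_nonpos_iff.2 (Or.inl ⟨hW i hi, ?_⟩)
  have e1 : gksExpect s (affCpl K W t) C (fun σ => spinAt x σ * spinAt y σ * spinAt z σ) =
      gksExpect s (affCpl K W t) C (fun σ => spinAt x σ * spinAt y σ * spinAt z σ) := rfl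
  nlinarith [hghs, e1]

/-- **GHS concavity of the one-point function along a nonnegative one-site deformation**
(Griffiths–Hurst–Sherman 1970; Friedli–Velenik 2017, §3.9, p. 140: "`∂²⟨σ_k⟩/∂hᵢ∂hⱼ ≤ 0` …
provided that `h_ℓ ≥ 0`"; the tool of the GHS route to uniqueness, Remark 3.41): for a spin
system with supports of at most two sites, a direction `W ≥ 0` acting only on one-site terms,
and `t₀` such that all couplings `K + t₀W` are nonnegative, `t ↦ ⟨σₓ⟩_{K+tW}` is concave on
`[t₀, ∞)`. [cite: FriedliVelenik2017, §3.9, p. 140, and Remark 3.41] [cite: Lebowitz1974, eq. (1.8)] -/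
theorem concaveOn_gksExpect_spinAt_affCpl (hC : ∀ i ∈ s, (C i).card ≤ 2)
    (hW : ∀ i ∈ s, 0 ≤ W i) (hW1 : ∀ i ∈ s, W i ≠ 0 → ∃ z, C i = {z}) {t₀ : ℝ}
    (hK0 : ∀ i ∈ s, 0 ≤ affCpl K W t₀ i) (x : Λ) :
    ConcaveOn ℝ (Ici t₀) (fun t => gksExpect s (affCpl K W t) C (spinAt x)) := by
  -- couplings stay nonnegative to the right of `t₀`
  have hKt : ∀ t, t₀ ≤ t → ∀ i ∈ s, 0 ≤ affCpl K W t i := by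
    intro t ht i hi
    have h0 := hK0 i hi
    simp only [affCpl] at h0 ⊢
    nlinarith [hW i hi]
  have hderiv := fun t => hasDerivAt_gksExpect_affCpl_cov s K W C (spinAt x) t
  refine AntitoneOn.concaveOn_of_deriv (convex_Ici t₀)
    (fun t _ => (hderiv t).continuousAt.continuousWithinAt)
    (fun t _ => (hderiv t).differentiableAt.differentiableWithinAt) ?_
  rw [interior_Ici]
  have hderiv_eq : deriv (fun t => gksExpect s (affCpl K W t) C (spinAt x)) =
      fun t => ∑ i ∈ s, W i * (gksExpect s (affCpl K W t) C
        (fun ω => spinAt x ω * spinProduct (C i) ω) -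
        gksExpect s (affCpl K W t) C (spinAt x) *
          gksExpect s (affCpl K W t) C (spinProduct (C i))) :=
    funext fun t => (hderiv t).deriv
  rw [hderiv_eq]
  -- each term is antitone on `(t₀, ∞)`
  have hterm : ∀ i ∈ s, AntitoneOn (fun t => W i * (gksExpect s (affCpl K W t) C
      (fun ω => spinAt x ω * spinProduct (C i) ω) -
      gksExpect s (affCpl K W t) C (spinAt x) *
        gksExpect s (affCpl K W t) C (spinProduct (C i)))) (Ioi t₀) := by
    intro i hi
    by_cases hWi : W i = 0
    · intro a _ b _ _; simp [hWi]
    obtain ⟨z, hz⟩ := hW1 i hi hWi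
    have hsp : spinProduct (C i) = spinAt z := by
      funext σ; rw [hz, spinProduct, Finset.prod_singleton]
    simp only [hsp]
    have hd := fun t => hasDerivAt_gksTrunc_affCpl s K W C x z t
    have hanti : AntitoneOn (fun t => gksExpect s (affCpl K W t) C (fun σ => spinAt x σ * spinAt z σ) -
        gksExpect s (affCpl K W t) C (spinAt x) * gksExpect s (affCpl K W t) C (spinAt z))
        (Ioi t₀) := by
      refine antitoneOn_of_deriv_nonpos (convex_Ioi t₀)
        (fun t _ => (hd t).continuousAt.continuousWithinAt)
        (fun t _ => (hd t).differentiableAt.differentiableWithinAt) ?_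
      rw [interior_Ioi]
      intro t ht
      rw [(hd t).deriv]
      exact deriv_gksTrunc_affCpl_nonpos s K W C hC hW hW1 (hKt t (le_of_lt ht)) x z
    intro a ha b hb hab
    exact mul_le_mul_of_nonneg_left (hanti ha hb hab) (hW i hi)
  intro a ha b hb hab
  exact Finset.sum_le_sum fun i hi => hterm i hi ha hb hab

end Deform

/-! ## Part C. The fixed-b.c. Ising model with an extra field `t` on a set of sites `D` -/

section IsingDeform

variable {V : Type*} [DecidableEq V] (G : SimpleGraph V) [G.LocallyFinite]

/-- The direction "unit field on the sites of `D`": `0` on bonds, `𝟙_D` on sites. [folklore] -/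
def siteDir (D : Finset V) : Sym2 V ⊕ V → ℝ
  | .inl _ => 0
  | .inr y => if y ∈ D then 1 else 0

/-- `siteDir` on a bond index. [folklore] -/
@[simp] theorem siteDir_inl (D : Finset V) (e : Sym2 V) : siteDir D (.inl e) = 0 := rfl

/-- `siteDir` on a site index. [folklore] -/
@[simp] theorem siteDir_inr (D : Finset V) (y : V) :
    siteDir D (.inr y) = if y ∈ D then 1 else 0 := rfl

/-- `siteDir ≥ 0`. [folklore] -/
theorem siteDir_nonneg (D : Finset V) : ∀ i, 0 ≤ siteDir D i := by
  rintro (e | y)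
  · simp
  · simp only [siteDir_inr]; split_ifs <;> norm_num

/-- `siteDir` acts only on one-site terms of the effective-field representation. [folklore] -/
theorem siteDir_ne_zero_imp {Λ : Finset V} (D : Finset V) :
    ∀ i ∈ effIdx G Λ, siteDir D i ≠ 0 → ∃ z, isingSupp Λ i = {z} := by
  rintro (e | y) hi hne
  · simp at hne
  · rw [effIdx, Finset.inr_mem_disjSum] at hi
    exact ⟨⟨y, hi⟩, isingSupp_inr_eq_singleton hi⟩

/-- **The deformed expectation** `⟨F⟩^{η}_{Λ;β,h;t·𝟙_D}`: the fixed-b.c. Ising weights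
`exp(-βH^η_{Λ;h})` tilted by `exp(t ∑_{y ∈ D ∩ Λ} σ_y)` — an extra magnetic field `t` (in
coupling units) on the sites of `D` (the one-parameter family of the GHS route to uniqueness,
Friedli–Velenik 2017, Remark 3.41; Preston 1974). [cite: FriedliVelenik2017, Remark 3.41] -/
def deformedExpect (Λ : Finset V) (β h : ℝ) (η : SpinConfig V) (D : Finset V) (t : ℝ)
    (F : SpinConfig ↥Λ → ℝ) : ℝ :=
  gksExpect (effIdx G Λ) (affCpl (effCoupling G Λ β h η) (siteDir D) t) (isingSupp Λ) F

/-- **The deformed partition function** `Z^{η}_{Λ;β,h;t·𝟙_D}`. [cite: FriedliVelenik2017, Remark 3.41] -/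
def deformedZ (Λ : Finset V) (β h : ℝ) (η : SpinConfig V) (D : Finset V) (t : ℝ) : ℝ :=
  gksSum (effIdx G Λ) (affCpl (effCoupling G Λ β h η) (siteDir D) t) (isingSupp Λ) (fun _ => 1)

/-- `Z_t > 0`. [folklore] -/
theorem deformedZ_pos (Λ : Finset V) (β h : ℝ) (η : SpinConfig V) (D : Finset V) (t : ℝ) :
    0 < deformedZ G Λ β h η D t :=
  gksSum_one_pos _ _ _

/-- **At `t = 0` the deformed expectation is the Ising expectation**:
`⟨τ ↦ f(τ·η)⟩_{t=0} = ⟨f⟩^η_{Λ;β,h}` for measurable `f`. [cite: FriedliVelenik2017, §3.8.1, p. 141] -/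
theorem deformedExpect_zero (Λ : Finset V) (β h : ℝ) (η : SpinConfig V) (D : Finset V)
    {f : SpinConfig V → ℝ} (hf : Measurable f) :
    deformedExpect G Λ β h η D 0 (fun τ => f (glue Λ τ (.fixed η))) =
      isingExpect G Λ β h (.fixed η) f := by
  rw [deformedExpect, affCpl_zero, isingExpect_fixed_eq_gksExpect_eff G Λ β h η hf]

/-- At `t = 0`, one-point functions: `⟨σ_y⟩_{t=0} = ⟨σ_y⟩^η_{Λ;β,h}` (`y ∈ Λ`).
[cite: FriedliVelenik2017, §3.8.1, p. 141] -/
theorem deformedExpect_zero_spinAt (Λ : Finset V) (β h : ℝ) (η : SpinConfig V) (D : Finset V)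
    {y : V} (hy : y ∈ Λ) :
    deformedExpect G Λ β h η D 0 (spinAt ⟨y, hy⟩) = isingExpect G Λ β h (.fixed η) (spinAt y) := by
  rw [deformedExpect, affCpl_zero, isingExpect_spinAt_fixed_eq_gksExpect_eff G Λ β h η hy]

/-- At `t = 0`, the partition function: `Z_0 = Z^η_{Λ;β,h}`. [cite: FriedliVelenik2017, §3.8.1, p. 141] -/
theorem deformedZ_zero (Λ : Finset V) (β h : ℝ) (η : SpinConfig V) (D : Finset V) :
    deformedZ G Λ β h η D 0 = isingPartitionFunction G Λ β h (.fixed η) := by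
  rw [deformedZ, affCpl_zero, isingPartitionFunction_eq_gksSum_eff]

/-- **Nonnegative couplings along the deformation**: if `β ≥ 0`, every site of `Λ` has a
nonnegative effective field `h + ∑_{z∼y, z∉Λ} η_z ≥ 0`, and the sites of `D` have effective
field `≥ m`, then all couplings of `K_eff + t·𝟙_D` are nonnegative for `t ≥ -βm`.
[cite: FriedliVelenik2017, §3.9, p. 140 (the hypothesis h_ℓ ≥ 0 of GHS)] -/
theorem affCpl_effCoupling_siteDir_nonneg {Λ : Finset V} {β h m : ℝ} (hβ : 0 ≤ β)
    {η : SpinConfig V} {D : Finset V} (hfield : ∀ y ∈ Λ, 0 ≤ h + bdryField G Λ η y)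
    (hD : ∀ y ∈ Λ, y ∈ D → m ≤ h + bdryField G Λ η y) {t : ℝ} (ht : -(β * m) ≤ t) :
    ∀ i ∈ effIdx G Λ, 0 ≤ affCpl (effCoupling G Λ β h η) (siteDir D) t i := by
  rintro (e | y) hi
  · simp [affCpl, hβ]
  · rw [effIdx, Finset.inr_mem_disjSum] at hi
    simp only [affCpl, effCoupling_inr, siteDir_inr]
    split_ifs with hyD
    · have := hD y hi hyD
      nlinarith
    · rw [mul_zero, add_zero]
      exact mul_nonneg hβ (hfield y hi)

/-- **GHS concavity of the deformed one-point function** (Friedli–Velenik 2017, Remark 3.41 /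
§3.9: the magnetisation is concave in nonnegative fields): under the hypotheses of
`affCpl_effCoupling_siteDir_nonneg`, `t ↦ ⟨σₓ⟩_{t}` is concave on `[-βm, ∞)`.
[cite: FriedliVelenik2017, Remark 3.41 and §3.9, p. 140] [cite: Lebowitz1974, eq. (1.8)] -/
theorem concaveOn_deformedExpect_spinAt {Λ : Finset V} {β h m : ℝ} (hβ : 0 ≤ β)
    {η : SpinConfig V} {D : Finset V} (hfield : ∀ y ∈ Λ, 0 ≤ h + bdryField G Λ η y)
    (hD : ∀ y ∈ Λ, y ∈ D → m ≤ h + bdryField G Λ η y) (x : ↥Λ) :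
    ConcaveOn ℝ (Ici (-(β * m))) (fun t => deformedExpect G Λ β h η D t (spinAt x)) :=
  concaveOn_gksExpect_spinAt_affCpl (effIdx G Λ) (effCoupling G Λ β h η) (siteDir D) (isingSupp Λ)
    (fun i _ => card_isingSupp_le_two Λ i) (fun i _ => siteDir_nonneg D i)
    (siteDir_ne_zero_imp G D) (affCpl_effCoupling_siteDir_nonneg G hβ hfield hD le_rfl) x

/-- The mean energy in the direction `𝟙_D` is the total magnetisation of `D ∩ Λ`:
`∑ᵢ (𝟙_D)ᵢ ⟨σ_{Cᵢ}⟩_t = ∑_{y ∈ Λ, y ∈ D} ⟨σ_y⟩_t`. [folklore] -/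
theorem sum_siteDir_mul_deformedExpect (Λ : Finset V) (β h : ℝ) (η : SpinConfig V)
    (D : Finset V) (t : ℝ) :
    ∑ i ∈ effIdx G Λ, siteDir D i *
        gksExpect (effIdx G Λ) (affCpl (effCoupling G Λ β h η) (siteDir D) t) (isingSupp Λ)
          (spinProduct (isingSupp Λ i)) =
      ∑ y ∈ (Λ.filter fun y => y ∈ D).attach,
        deformedExpect G Λ β h η D t (spinAt ⟨y.1, (Finset.mem_filter.1 y.2).1⟩) := by
  rw [effIdx, Finset.sum_disjSum]
  simp only [siteDir_inl, zero_mul, Finset.sum_const_zero, zero_add, siteDir_inr, ite_mul,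
    one_mul, zero_mul]
  rw [Finset.sum_ite, Finset.sum_const_zero, add_zero, ← Finset.sum_attach]
  refine Finset.sum_congr rfl fun y _ => ?_
  have hy : y.1 ∈ Λ := (Finset.mem_filter.1 y.2).1
  rw [deformedExpect, isingSupp_inr_eq_singleton hy]
  congr 1
  funext σ
  rw [spinProduct, Finset.prod_singleton]

/-- The total `D`-magnetisation `M_D(t) = ∑_{y ∈ Λ ∩ D} ⟨σ_y⟩_t` of the deformed system.
[cite: FriedliVelenik2017, §3.7, proof of Prop. 3.29 (m_Λ = ∂ψ_Λ/∂h)] -/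
def deformedMag (Λ : Finset V) (β h : ℝ) (η : SpinConfig V) (D : Finset V) (t : ℝ) : ℝ :=
  ∑ y ∈ (Λ.filter fun y => y ∈ D).attach,
    deformedExpect G Λ β h η D t (spinAt ⟨y.1, (Finset.mem_filter.1 y.2).1⟩)

/-- **`d/dt log Z_t = M_D(t)`**. [cite: FriedliVelenik2017, §3.7, proof of Prop. 3.29] -/
theorem hasDerivAt_log_deformedZ (Λ : Finset V) (β h : ℝ) (η : SpinConfig V) (D : Finset V)
    (t : ℝ) :
    HasDerivAt (fun t => Real.log (deformedZ G Λ β h η D t)) (deformedMag G Λ β h η D t) t := by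
  have := hasDerivAt_log_gksSum_affCpl (effIdx G Λ) (effCoupling G Λ β h η) (siteDir D)
    (isingSupp Λ) t
  rw [sum_siteDir_mul_deformedExpect] at this
  exact this

/-- **`M_D` is nondecreasing in `t`** (convexity of `log Z_t`). [cite: FriedliVelenik2017, §3.7, Prop. 3.29] -/
theorem monotone_deformedMag (Λ : Finset V) (β h : ℝ) (η : SpinConfig V) (D : Finset V) :
    Monotone (deformedMag G Λ β h η D) := by
  have := monotone_sum_gksExpect_affCpl (effIdx G Λ) (effCoupling G Λ β h η) (siteDir D)
    (isingSupp Λ)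
  intro a b hab
  have h := this hab
  simp only [sum_siteDir_mul_deformedExpect] at h
  exact h

/-- **`(t₂-t₁) M_D(t₁) ≤ log Z_{t₂} - log Z_{t₁} ≤ (t₂-t₁) M_D(t₂)`** for `t₁ ≤ t₂`.
[cite: FriedliVelenik2017, §3.7, Prop. 3.29 and its proof] -/
theorem log_deformedZ_sub_mem (Λ : Finset V) (β h : ℝ) (η : SpinConfig V) (D : Finset V)
    {t₁ t₂ : ℝ} (ht : t₁ ≤ t₂) :
    (t₂ - t₁) * deformedMag G Λ β h η D t₁ ≤
        Real.log (deformedZ G Λ β h η D t₂) - Real.log (deformedZ G Λ β h η D t₁) ∧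
      Real.log (deformedZ G Λ β h η D t₂) - Real.log (deformedZ G Λ β h η D t₁) ≤
        (t₂ - t₁) * deformedMag G Λ β h η D t₂ := by
  have := log_gksSum_affCpl_sub_mem (effIdx G Λ) (effCoupling G Λ β h η) (siteDir D)
    (isingSupp Λ) ht
  simp only [sum_siteDir_mul_deformedExpect] at this
  exact this

/-- **Two boundary conditions**: the deformed partition functions of `η` and `η'` (same `Λ`, `β`,
`h`, `D`, `t`) satisfy `|log Z_t^η - log Z_t^{η'}| ≤ |β| ∑_{y ∈ Λ} |∑_{z∼y,z∉Λ} (η_z - η'_z)|`.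
[cite: FriedliVelenik2017, §3.2.1, proof of Thm. 3.6 (boundary terms)] -/
theorem abs_log_deformedZ_sub_le (Λ : Finset V) (β h : ℝ) (η η' : SpinConfig V) (D : Finset V)
    (t : ℝ) :
    |Real.log (deformedZ G Λ β h η D t) - Real.log (deformedZ G Λ β h η' D t)| ≤
      |β| * ∑ y ∈ Λ, |bdryField G Λ η y - bdryField G Λ η' y| := by
  have h0 := abs_log_gksSum_sub_log_gksSum_le (effIdx G Λ)
    (affCpl (effCoupling G Λ β h η) (siteDir D) t) (isingSupp Λ)
    (affCpl (effCoupling G Λ β h η') (siteDir D) t)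
  refine h0.trans (le_of_eq ?_)
  rw [effIdx, Finset.sum_disjSum, Finset.mul_sum]
  simp only [affCpl, effCoupling_inl, sub_self, abs_zero, Finset.sum_const_zero, zero_add,
    effCoupling_inr]
  refine Finset.sum_congr rfl fun y _ => ?_
  rw [← abs_mul]
  congr 1
  ring

end IsingDeform

end Literature.Probability.LatticeModels
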